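import Literature.NumberTheory.EllipticCurves.SelmerCorankControlRatOrdinaryLayerUniformizerProofs
import Literature.NumberTheory.EllipticCurves.SelmerCorankControlRatOrdinaryLayerTwoProofs
import Literature.NumberTheory.EllipticCurves.SelmerCorankControlRatOrdinaryLayerKummerCountProofs
import Summits.BirchSwinnertonDyer.BirchSwinnertonDyer.Theorems.AlignedTransportAtTwoMainConjectureOfRankZeroBSDAtTwoSelmerLayerControlLocal
import HarnessLib

/-!
# Route `AlignedTransportAtTwo`, crux C2 `MainConjectureOfRankZeroBSDAtTwo` (stmt-BirchSwinnertonDyer-22298):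
# THE TWO-SIDED LAYER-ONE MATCHING AT `p = 2` MODULO THE KUMMER COUNT OVER `ℚ₂(√2)` ALONE

HONEST FRAMING (cell `bsd-f1-sign2`, WIDTH-5 attached prover seat `bsd-line-att-p5` gen 41 on line `birth` of the
lead `bsd-line-att-p2`; `--supports` stmt-BirchSwinnertonDyer-22298, closes nothing; BSD is NOT proved by any of this;
the crux C2, its verdict «blocked-on `Rank1Residual.GreenbergMuConjectureIrreducible`» and every registered stub are
untouched). THEOREMS ONLY — no `def`, no instance, no named fact, no `sorry`.

Gen 40 of this lineage (`…SelmerLayerControlLocal`) displayed the ONE local input of the layer-one control theorem at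
`p = 2` and of the two-sided matching `rank_{ℤ₂} X/(T+2)X = corank_{ℤ₂} Sel_{2^∞}(W⁽²⁾/ℚ)`: the finiteness of
`𝒦_{v,1}[2^∞] = ker(H¹(ℚ₂(√2), E) → H¹(ℚ_{2,∞}, E))[2^∞]` (Greenberg's Lemma 3.4 at the layer `n = 1`, finiteness
clause; the tree proves the layer `0` only). Gen 41 carried the elementary layer-`0` proof of Lemma 3.4 to every layer
in `Literature/NumberTheory/EllipticCurves/` (`IwasawaLocalKummerSkeletonKummerSetProofs`: the rank-free Kummer-set
skeleton; `SelmerCorankControlRatOrdinaryLayerProofs`: layer `n` modulo (C1ₙ), (C2ₙ); `FormalGroupKummerPointsRankProofs`: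
(C2ₙ) from a uniformiser-like `π`; `LocalLayerValuationBoundProofs`: the value bound; `…LayerUniformizerProofs`: layer `n`
modulo (C1ₙ) alone given `π`, and `p = 2`, `n = 1` with `π = √2`). **This file books the consequence for the crux ledger:**

* ★★ `finite_localTowerKerPrimary_one_of_kummerCount` — for `W/ℚ` globally minimal, good ordinary at `2`, `κ` cyclotomic:
  `𝒦_{v,1}[2^∞]` is finite at `v ∣ 2` AS SOON AS, for the spectral valuation `w` of `K̄_v`, **the KUMMER COUNT (C1₁)** holds —
  for every `k` the continuous cocycles of `H_{v,1} = (Γ_{ℚ₂} → Γ_ℚ)⁻¹(Gal(ℚ̄/ℚ(√2)))` with values in `E₁ ∩ E[2^k]` fall into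
  at most `c₀ · 4^k` classes modulo coboundaries of `2^k`-torsion points ("`#H¹(ℚ₂(√2), C[2^k]) ≤ c₀ 4^k`", `C = Ê[2^∞]`;
  Greenberg, LNM 1716, §2 Prop. 2.2, p. 73: `H¹(M, C)` has corank `[M : ℚ₂] = 2`; the tree proves the analogous count
  over `ℚ₂` itself, `OrdinaryLocalKummerCountProofs`, but not yet over the RAMIFIED `ℚ₂(√2)`);
* ★★★ `lambdaInvariant_quotient_X_add_two_eq_selmerCorank_quadraticTwist_of_kummerCount` — **the two-sided layer-one
  matching `rank_{ℤ₂} X/(T+2)X = corank_{ℤ₂} Sel_{2^∞}(W⁽²⁾/ℚ)` modulo (C1₁) alone**.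

So the lineage's chain «`j := ord_{T+2} f_X` vs `e₀ := s₂(W⁽²⁾)`» (gens 38–40) now rests on a single purely local
cohomological count, with every piece of elliptic-curve arithmetic (ordinary filtration, formal group, Frobenius,
`√2 ∈ ℚ_1`, value bound) discharged in the tree.

References: R. Greenberg, LNM 1716 (1999), §3 Lemma 3.4 (p. 89), §2 Prop. 2.2 (p. 73), Thm. 1.2 [GreenbergLNM1716];
L. Washington, GTM 83, §13.1 [Washington1997].
-/

set_option linter.dupNamespace false
set_option autoImplicit false

noncomputable section

open scoped Classical AddSubgroup NNReal

universe u

namespace Summit.BirchSwinnertonDyer.BirchSwinnertonDyer.Theorems.AlignedTransportAtTwoSelmerLayerKummerCount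

open NumberField IsDedekindDomain WeierstrassCurve Literature.NumberTheory.EllipticCurves
  Literature.NumberTheory.GaloisRepresentations Literature.NumberTheory.EllipticCurves.FormalGroupChart
  Summit.BirchSwinnertonDyer.BirchSwinnertonDyer.Theorems.AlignedTransportAtTwoSelmerLayerControlLocal

variable (W : WeierstrassCurve ℚ) [W.IsElliptic] [W.IsGloballyMinimal] {κ : ZpExtension ℚ 2}
  {γ : Field.absoluteGaloisGroup ℚ}

/-- ★★ **Lemma 3.4 at the first layer for `p = 2` modulo the Kummer count over `ℚ₂(√2)`.** For `W/ℚ` globally minimal,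
good ordinary at `2`, and the cyclotomic `ℤ₂`-extension `κ`: if at every `v ∣ 2`, for every spectral valuation `w` of
`K̄_v` and every `w`-integrality witness of `W ⊗ K̄_v`, there is `c₀` such that for every `k` the continuous cocycles of
`H_{v,1}` with values in `E₁ ∩ E[2^k]` (`E₁ = FormalGroupChart.kernel w (W ⊗ K̄_v)`) fall into `≤ c₀ · 2^{2k}` classes modulo
coboundaries of `2^k`-torsion points, then `𝒦_{v,1}[2^∞] = W.localTowerKerPrimary κ ℚ_v 1` is finite at every `v ∣ 2`
(`WeierstrassCurve.finite_localTowerKerPrimary_one_of_ordinary_two_of_count`, with the spectral valuation of the tree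
and the integral model `W_ℤ ⊗ 𝒪_w`). [cite: GreenbergLNM1716, §3 Lemma 3.4 (p. 89)] -/
theorem finite_localTowerKerPrimary_one_of_kummerCount (h2 : IsOrdinaryAt W 2) (hκ : κ.IsCyclotomic)
    (hC1 : ∀ v : HeightOneSpectrum (𝓞 ℚ), (2 : 𝓞 ℚ) ∈ v.asIdeal →
      ∀ (w : Valuation (AlgebraicClosure (v.adicCompletion ℚ)) ℝ≥0),
        (∀ x, (w x : ℝ) = spectralNorm (v.adicCompletion ℚ) (AlgebraicClosure (v.adicCompletion ℚ)) x) →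
        ∀ [(W.baseChange (AlgebraicClosure (v.adicCompletion ℚ))).IsIntegral w.integer],
        ∃ c₀ : ℕ, ∀ k : ℕ, ∃ S : Finset (contOneCocycles (discreteTopRep
          (localSubgroup (κ.layerSubgroup 1) (v.adicCompletion ℚ)) (localPoints W (v.adicCompletion ℚ)))),
          S.card ≤ c₀ * 2 ^ (2 * k) ∧ ∀ ψ : contOneCocycles (discreteTopRep
            (localSubgroup (κ.layerSubgroup 1) (v.adicCompletion ℚ)) (localPoints W (v.adicCompletion ℚ))),
            (∀ g, 2 ^ k • ψ.1 g = 0) →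
            (∀ g, ((ψ.1 g : localPoints W (v.adicCompletion ℚ)) :
              (W.baseChange (AlgebraicClosure (v.adicCompletion ℚ))).toAffine.Point) ∈
                kernel w (W.baseChange (AlgebraicClosure (v.adicCompletion ℚ)))) →
              ∃ ψ₀ ∈ S, ∃ t : localPoints W (v.adicCompletion ℚ), 2 ^ k • t = 0 ∧
                ∀ g, ψ.1 g - ψ₀.1 g = g • t - t)
    (v : HeightOneSpectrum (𝓞 ℚ)) (hv : (2 : 𝓞 ℚ) ∈ v.asIdeal) :
    Finite (W.localTowerKerPrimary κ (v.adicCompletion ℚ) 1) := by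
  obtain ⟨w, hw⟩ := v.exists_spectralValuation
  haveI hV : (W.baseChange (AlgebraicClosure (v.adicCompletion ℚ))).IsIntegral w.integer :=
    ⟨⟨(integralModelInt W).map (algebraMap ℤ ↥w.integer),
      W.baseChange_eq_localIntModel_integer_baseChange⟩⟩
  obtain ⟨c₀, hc₀⟩ := hC1 v hv w hw
  have hΔ := W.not_dvd_minimalDiscriminantInt_of_hasGoodReductionAtPrime' 2 h2.1
  exact W.finite_localTowerKerPrimary_one_of_ordinary_two_of_count hw (by exact_mod_cast hv) hΔ h2.2 κ hκ
    hc₀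

/-- ★★★ **`rank_{ℤ₂} X/(T+2)X = corank_{ℤ₂} Sel_{2^∞}(W⁽²⁾/ℚ)` modulo the Kummer count over `ℚ₂(√2)` alone** (`W/ℚ`
globally minimal, good ordinary at `2`, `κ` cyclotomic with topological generator `γ`, `D` any Selmer dual datum): the
lineage's two-sided layer-one matching
(`…SelmerLayerControlLocal.lambdaInvariant_quotient_X_add_two_eq_selmerCorank_quadraticTwist_of_finite_localTowerKerPrimary_two`)
with its one local input — Lemma 3.4 at `n = 1` — discharged down to the cocycle count (C1₁)
(`finite_localTowerKerPrimary_one_of_kummerCount`). The unconditional half `≤` is the tree's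
`selmerCorank_quadraticTwist_le_lambdaInvariant_quotient_X_add_two`.
[cite: GreenbergLNM1716, Thm 1.2, §3 Lemma 3.4 (p. 89), §2 Prop. 2.2 (p. 73)] -/
theorem lambdaInvariant_quotient_X_add_two_eq_selmerCorank_quadraticTwist_of_kummerCount
    (h2 : IsOrdinaryAt W 2) (hκ : κ.IsCyclotomic) (hγ : κ.IsTopGenerator γ) (D : W.SelmerDualData κ γ)
    (hC1 : ∀ v : HeightOneSpectrum (𝓞 ℚ), (2 : 𝓞 ℚ) ∈ v.asIdeal →
      ∀ (w : Valuation (AlgebraicClosure (v.adicCompletion ℚ)) ℝ≥0),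
        (∀ x, (w x : ℝ) = spectralNorm (v.adicCompletion ℚ) (AlgebraicClosure (v.adicCompletion ℚ)) x) →
        ∀ [(W.baseChange (AlgebraicClosure (v.adicCompletion ℚ))).IsIntegral w.integer],
        ∃ c₀ : ℕ, ∀ k : ℕ, ∃ S : Finset (contOneCocycles (discreteTopRep
          (localSubgroup (κ.layerSubgroup 1) (v.adicCompletion ℚ)) (localPoints W (v.adicCompletion ℚ)))),
          S.card ≤ c₀ * 2 ^ (2 * k) ∧ ∀ ψ : contOneCocycles (discreteTopRep
            (localSubgroup (κ.layerSubgroup 1) (v.adicCompletion ℚ)) (localPoints W (v.adicCompletion ℚ))),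
            (∀ g, 2 ^ k • ψ.1 g = 0) →
            (∀ g, ((ψ.1 g : localPoints W (v.adicCompletion ℚ)) :
              (W.baseChange (AlgebraicClosure (v.adicCompletion ℚ))).toAffine.Point) ∈
                kernel w (W.baseChange (AlgebraicClosure (v.adicCompletion ℚ)))) →
              ∃ ψ₀ ∈ S, ∃ t : localPoints W (v.adicCompletion ℚ), 2 ^ k • t = 0 ∧
                ∀ g, ψ.1 g - ψ₀.1 g = g • t - t) :
    lambdaInvariant 2 (D.X ⧸ (Ideal.span {(PowerSeries.X + 2 : IwasawaAlgebra 2)} • ⊤ : Submodule (IwasawaAlgebra 2) D.X)) =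
      (W.quadraticTwist 2).selmerCorank 2 :=
  lambdaInvariant_quotient_X_add_two_eq_selmerCorank_quadraticTwist_of_finite_localTowerKerPrimary_two W h2 hκ hγ D
    (fun v hv ↦ finite_localTowerKerPrimary_one_of_kummerCount W h2 hκ hC1 v hv)

/-! ## Appendix (same seat, same gen): EVERY layer `n` of the cyclotomic `ℤ₂`-tower -/

/-- ★★ **Lemma 3.4 at the layer `n` for `p = 2` modulo the Kummer count over `(ℚ_n)_2`.** For `W/ℚ` globally minimal, good
ordinary at `2`, the cyclotomic `ℤ₂`-extension `κ` and any `n`: if at every `v ∣ 2`, for the spectral valuation `w` and any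
integrality witness, there is `c₀` with the `E₁ ∩ E[2^k]`-valued cocycles of `H_{v,n}` falling into `≤ c₀ · 2^{2ⁿ k}` classes
modulo coboundaries of `2^k`-torsion points for every `k` ("`H¹((ℚ_n)_2, C)` has corank `2ⁿ`"), then `𝒦_{v,n}[2^∞]` is
finite at every `v ∣ 2` (`WeierstrassCurve.finite_localTowerKerPrimary_of_ordinary_two_of_count`: the uniformiser
`2 - (ζ_{2^{n+2}} + ζ_{2^{n+2}}⁻¹)` of `(ℚ_n)_2`). [cite: GreenbergLNM1716, §3 Lemma 3.4 (p. 89)] [cite: Washington1997, §13.1] -/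
theorem finite_localTowerKerPrimary_of_kummerCount (h2 : IsOrdinaryAt W 2) (hκ : κ.IsCyclotomic) (n : ℕ)
    (hC1 : ∀ v : HeightOneSpectrum (𝓞 ℚ), (2 : 𝓞 ℚ) ∈ v.asIdeal →
      ∀ (w : Valuation (AlgebraicClosure (v.adicCompletion ℚ)) ℝ≥0),
        (∀ x, (w x : ℝ) = spectralNorm (v.adicCompletion ℚ) (AlgebraicClosure (v.adicCompletion ℚ)) x) →
        ∀ [(W.baseChange (AlgebraicClosure (v.adicCompletion ℚ))).IsIntegral w.integer],
        ∃ c₀ : ℕ, ∀ k : ℕ, ∃ S : Finset (contOneCocycles (discreteTopRep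
          (localSubgroup (κ.layerSubgroup n) (v.adicCompletion ℚ)) (localPoints W (v.adicCompletion ℚ)))),
          S.card ≤ c₀ * 2 ^ (2 ^ n * k) ∧ ∀ ψ : contOneCocycles (discreteTopRep
            (localSubgroup (κ.layerSubgroup n) (v.adicCompletion ℚ)) (localPoints W (v.adicCompletion ℚ))),
            (∀ g, 2 ^ k • ψ.1 g = 0) →
            (∀ g, ((ψ.1 g : localPoints W (v.adicCompletion ℚ)) :
              (W.baseChange (AlgebraicClosure (v.adicCompletion ℚ))).toAffine.Point) ∈
                kernel w (W.baseChange (AlgebraicClosure (v.adicCompletion ℚ)))) →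
              ∃ ψ₀ ∈ S, ∃ t : localPoints W (v.adicCompletion ℚ), 2 ^ k • t = 0 ∧
                ∀ g, ψ.1 g - ψ₀.1 g = g • t - t)
    (v : HeightOneSpectrum (𝓞 ℚ)) (hv : (2 : 𝓞 ℚ) ∈ v.asIdeal) :
    Finite (W.localTowerKerPrimary κ (v.adicCompletion ℚ) n) := by
  obtain ⟨w, hw⟩ := v.exists_spectralValuation
  haveI hV : (W.baseChange (AlgebraicClosure (v.adicCompletion ℚ))).IsIntegral w.integer :=
    ⟨⟨(integralModelInt W).map (algebraMap ℤ ↥w.integer),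
      W.baseChange_eq_localIntModel_integer_baseChange⟩⟩
  obtain ⟨c₀, hc₀⟩ := hC1 v hv w hw
  have hΔ := W.not_dvd_minimalDiscriminantInt_of_hasGoodReductionAtPrime' 2 h2.1
  exact W.finite_localTowerKerPrimary_of_ordinary_two_of_count hw (by exact_mod_cast hv) hΔ h2.2 κ hκ n
    hc₀

/-- ★★★ **Layer-`n` corank control over `ℚ` at `p = 2`, `corank_{ℤ₂} Sel_{2^∞}(E_{ℚ_n}/ℚ_n) = rank_{ℤ₂} X/ω_n X`, modulo
the Kummer count over `(ℚ_n)_2` alone** (`W/ℚ` globally minimal, good ordinary at `2`, `κ` cyclotomic with topological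
generator `γ`, any dual datum with `X` finitely generated): gen 40's
`…SelmerLayerControlLocal.selmerCorank_layer_eq_lambdaInvariant_layerQuotient_of_finite_localTowerKerPrimary_dvd` with its
local input at `2` discharged down to (C1ₙ) (`finite_localTowerKerPrimary_of_kummerCount`).
[cite: GreenbergLNM1716, Thm 1.2 and §3 Lemma 3.4 (p. 89)] -/
theorem selmerCorank_layer_eq_lambdaInvariant_layerQuotient_two_of_kummerCount
    (h2 : IsOrdinaryAt W 2) (hκ : κ.IsCyclotomic) (hγ : κ.IsTopGenerator γ) (D : W.SelmerDualData κ γ)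
    [Module.Finite (IwasawaAlgebra 2) D.X] (n : ℕ)
    (hC1 : ∀ v : HeightOneSpectrum (𝓞 ℚ), (2 : 𝓞 ℚ) ∈ v.asIdeal →
      ∀ (w : Valuation (AlgebraicClosure (v.adicCompletion ℚ)) ℝ≥0),
        (∀ x, (w x : ℝ) = spectralNorm (v.adicCompletion ℚ) (AlgebraicClosure (v.adicCompletion ℚ)) x) →
        ∀ [(W.baseChange (AlgebraicClosure (v.adicCompletion ℚ))).IsIntegral w.integer],
        ∃ c₀ : ℕ, ∀ k : ℕ, ∃ S : Finset (contOneCocycles (discreteTopRep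
          (localSubgroup (κ.layerSubgroup n) (v.adicCompletion ℚ)) (localPoints W (v.adicCompletion ℚ)))),
          S.card ≤ c₀ * 2 ^ (2 ^ n * k) ∧ ∀ ψ : contOneCocycles (discreteTopRep
            (localSubgroup (κ.layerSubgroup n) (v.adicCompletion ℚ)) (localPoints W (v.adicCompletion ℚ))),
            (∀ g, 2 ^ k • ψ.1 g = 0) →
            (∀ g, ((ψ.1 g : localPoints W (v.adicCompletion ℚ)) :
              (W.baseChange (AlgebraicClosure (v.adicCompletion ℚ))).toAffine.Point) ∈
                kernel w (W.baseChange (AlgebraicClosure (v.adicCompletion ℚ)))) →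
              ∃ ψ₀ ∈ S, ∃ t : localPoints W (v.adicCompletion ℚ), 2 ^ k • t = 0 ∧
                ∀ g, ψ.1 g - ψ₀.1 g = g • t - t) :
    (W.baseChange (κ.layer n)).selmerCorank 2 =
      lambdaInvariant 2 (D.X ⧸ (Ideal.span {((1 + PowerSeries.X : PowerSeries ℤ_[2]) ^ (2 ^ n) - 1 : IwasawaAlgebra 2)} •
        ⊤ : Submodule (IwasawaAlgebra 2) D.X)) :=
  selmerCorank_layer_eq_lambdaInvariant_layerQuotient_of_finite_localTowerKerPrimary_dvd W κ hγ D n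
    (fun v hv ↦ finite_localTowerKerPrimary_of_kummerCount W h2 hκ n hC1 v hv)


/-! ## Appendix 2 (same seat lineage, gen 42): the Kummer count (C1ₙ) DISCHARGED — every statement above unconditional

The layer Kummer count (C1ₙ) is now a theorem of the tree
(`Literature/NumberTheory/EllipticCurves/SelmerCorankControlRatOrdinaryLayerKummerCountProofs`:
`WeierstrassCurve.exists_kummerCount_layer_of_ordinary`, from the cocycle count on the open subgroup `H_{v,n}`
(`SubgroupCyclotomicLineCocycleCountProofs`, Hilbert 90 over the layer `K̄_v^{N' ∩ H_{v,n}}`) and the twisted Kummer count over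
that RAMIFIED layer with uniformiser `π_n = 2 - (ζ_{2^{n+2}} + ζ_{2^{n+2}}⁻¹)` (`LocalLayerTwistedKummerCountProofs`,
`RamifiedLayerTwistedKummerProofs`)). Hence Greenberg's Lemma 3.4 holds at EVERY layer `n` of the cyclotomic `ℤ₂`-tower
for `E/ℚ` good ordinary at `2` (`WeierstrassCurve.finite_localTowerKerPrimary_of_ordinary_two`), and the three conditional
statements of this file become unconditional. COROLLARY-OF-PRINT (Greenberg LNM 1716 §3 Lemma 3.4 + §2 Prop. 2.2, now with an
elementary sorry-free proof at `p = 2`); nothing here is beyond print; BSD is not proved by any of this; C2 is not closed. -/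

/-- ★★★★ **Greenberg's Lemma 3.4 at EVERY layer `n` for `p = 2` — unconditional.** For `W/ℚ` globally minimal, good
ordinary at `2`, the cyclotomic `ℤ₂`-extension `κ`, any `n` and any `v ∣ 2`: `𝒦_{v,n}[2^∞] = W.localTowerKerPrimary κ ℚ_v n`
is finite (`WeierstrassCurve.finite_localTowerKerPrimary_of_ordinary_two`, with `2 ∤ Δ_W` from
`not_dvd_minimalDiscriminantInt_of_hasGoodReductionAtPrime'`). [cite: GreenbergLNM1716, §3 Lemma 3.4 (p. 89)] -/
theorem finite_localTowerKerPrimary_two (h2 : IsOrdinaryAt W 2) (hκ : κ.IsCyclotomic) (n : ℕ)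
    (v : HeightOneSpectrum (𝓞 ℚ)) (hv : (2 : 𝓞 ℚ) ∈ v.asIdeal) :
    Finite (W.localTowerKerPrimary κ (v.adicCompletion ℚ) n) := by
  have hΔ := W.not_dvd_minimalDiscriminantInt_of_hasGoodReductionAtPrime' 2 h2.1
  exact W.finite_localTowerKerPrimary_of_ordinary_two (by exact_mod_cast hv) hΔ h2.2 κ hκ n

/-- ★★★★ **`rank_{ℤ₂} X/(T+2)X = corank_{ℤ₂} Sel_{2^∞}(W⁽²⁾/ℚ)` — unconditional** (`W/ℚ` globally minimal, good ordinary
at `2`, `κ` cyclotomic with topological generator `γ`, `D` any Selmer dual datum): the lineage's two-sided layer-one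
matching (`…SelmerLayerControlLocal.lambdaInvariant_quotient_X_add_two_eq_selmerCorank_quadraticTwist_of_finite_localTowerKerPrimary_two`)
with its local input, Lemma 3.4 at `n = 1`, now a theorem (`finite_localTowerKerPrimary_two`).
[cite: GreenbergLNM1716, Thm 1.2, §3 Lemma 3.4 (p. 89), §2 Prop. 2.2 (p. 73)] -/
theorem lambdaInvariant_quotient_X_add_two_eq_selmerCorank_quadraticTwist
    (h2 : IsOrdinaryAt W 2) (hκ : κ.IsCyclotomic) (hγ : κ.IsTopGenerator γ) (D : W.SelmerDualData κ γ) :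
    lambdaInvariant 2 (D.X ⧸ (Ideal.span {(PowerSeries.X + 2 : IwasawaAlgebra 2)} • ⊤ : Submodule (IwasawaAlgebra 2) D.X)) =
      (W.quadraticTwist 2).selmerCorank 2 :=
  lambdaInvariant_quotient_X_add_two_eq_selmerCorank_quadraticTwist_of_finite_localTowerKerPrimary_two W h2 hκ hγ D
    (fun v hv ↦ finite_localTowerKerPrimary_two W h2 hκ 1 v hv)

/-- ★★★★ **Layer-`n` corank control over `ℚ` at `p = 2`, `corank_{ℤ₂} Sel_{2^∞}(E_{ℚ_n}/ℚ_n) = rank_{ℤ₂} X/ω_n X` —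
unconditional** (`W/ℚ` globally minimal, good ordinary at `2`, `κ` cyclotomic with topological generator `γ`, any dual datum
with `X` finitely generated, every `n`): gen 40's
`…SelmerLayerControlLocal.selmerCorank_layer_eq_lambdaInvariant_layerQuotient_of_finite_localTowerKerPrimary_dvd` with its local
input at `2` now a theorem (`finite_localTowerKerPrimary_two`). Mazur's control theorem in corank form at every layer of
the cyclotomic `ℤ₂`-tower, for good ordinary `2`. [cite: GreenbergLNM1716, Thm 1.2 and §3 Lemma 3.4 (p. 89)] -/
theorem selmerCorank_layer_eq_lambdaInvariant_layerQuotient_two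
    (h2 : IsOrdinaryAt W 2) (hκ : κ.IsCyclotomic) (hγ : κ.IsTopGenerator γ) (D : W.SelmerDualData κ γ)
    [Module.Finite (IwasawaAlgebra 2) D.X] (n : ℕ) :
    (W.baseChange (κ.layer n)).selmerCorank 2 =
      lambdaInvariant 2 (D.X ⧸ (Ideal.span {((1 + PowerSeries.X : PowerSeries ℤ_[2]) ^ (2 ^ n) - 1 : IwasawaAlgebra 2)} •
        ⊤ : Submodule (IwasawaAlgebra 2) D.X)) :=
  selmerCorank_layer_eq_lambdaInvariant_layerQuotient_of_finite_localTowerKerPrimary_dvd W κ hγ D n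
    (fun v hv ↦ finite_localTowerKerPrimary_two W h2 hκ n v hv)

end Summit.BirchSwinnertonDyer.BirchSwinnertonDyer.Theorems.AlignedTransportAtTwoSelmerLayerKummerCount

end
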